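import Summits.KontsevichZagierPeriods.KontsevichZagierPeriods.Theorems.LinRedNormalFormArrangementNormalFormSeparateAllHHNest
import Summits.KontsevichZagierPeriods.KontsevichZagierPeriods.Theorems.LinRedNormalFormArrangementNormalFormSeparateTwoCornerLog
import Summits.KontsevichZagierPeriods.KontsevichZagierPeriods.Theorems.LinRedNormalFormArrangementNormalFormSeparateTwoCorner

/-!
# The fibre mass along a nested thin sector of any depth: comparison lemmas

(Line `janus-bands`, crux `ArrangementNormalForm`, stub `stub_separateHigh_hH`, part `AllHHMass` of
the dimension-generic wall-invariant termwise-split lemma, base dimension `b + 1 ≥ 4` with fibres;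
namespace `SepAll`.)
Along a nested thin sector of depth `D` at a base point every atom `c` of the Janus fibre datum has
the NESTED VALUE `nval c₀ P w c = c₀ c + ∑_l cum w l · P l c` (`c₀ c` = value at the point,
`P l c` = slope along the `l`-th frame vector, `cum w l = w₀ ⋯ w_l`, part `AllHHNest`). This part
extends the two- and three-parameter fibre-mass comparisons (parts `Corner`, `CornerLog`, `HHKMass`)
to any depth:
* `anc_sep`: if all coordinates are at most `min (1/2) (g/(8R))` (`g` = common separation of the
  distinct values `c₀` and of the distinct slopes at every level, `R` = slope bound), distinct
  ANCHORS at level `r` (values with the levels `≥ r` switched off) are `(g/2) · w₀ ⋯ w_{r-1}` apart;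
* `lmass_level_log` / `lmass_level_nine`: contracting the single coordinate `w_r` by a factor
  `σ ∈ (0, 1]` (resp. `σ ∈ [1/4, 1]`) costs `(5 (1 + log σ⁻¹))^{k·#U}` (resp. `9^{k·#U}`) — one
  `SepTwo.lmass_contract` step about the anchors at level `r`, whose separation scales exactly like
  the core radius `D R · w₀ ⋯ w_r`, so that the admissible range `min (1/2) (g/(28 D R))` of every
  coordinate is uniform;
* `lmass_corner_mono_all` (registered as `separateAllHH_mass`): moving towards the corner within
  ratio `4` in every coordinate costs the constant `9^{D·k·#U}`.
-/

noncomputable section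

open Set Finset MeasureTheory
open scoped ENNReal

namespace Summit.KontsevichZagierPeriods.ArrangementNormalForm.JanusBands

namespace SepAll

open SepTwo

variable {k : ℕ} {ι : Type*} {D : ℕ}

/-! ### Nested values, anchors, prefix products -/

/-- The nested value of an atom along a nested sector. -/
def nval (c₀ : ι → ℝ) (P : Fin D → ι → ℝ) (w : Fin D → ℝ) (c : ι) : ℝ :=
  c₀ c + ∑ l, cum w l * P l c

/-- The anchor at level `r`: the nested value with the levels `≥ r` switched off. -/
def anc (c₀ : ι → ℝ) (P : Fin D → ι → ℝ) (r : ℕ) (w : Fin D → ℝ) (c : ι) : ℝ :=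
  c₀ c + ∑ l : Fin D, if (l : ℕ) < r then cum w l * P l c else 0

/-- The prefix product `w₀ ⋯ w_{r-1}`. -/
def pre (r : ℕ) (w : Fin D → ℝ) : ℝ := ∏ j : Fin D, if (j : ℕ) < r then w j else 1

/-- Nested products are prefix products. -/
theorem cum_eq_pre (w : Fin D → ℝ) (l : Fin D) : cum w l = pre ((l : ℕ) + 1) w := by
  unfold cum pre
  refine prod_congr rfl fun j _ => ?_
  have : (j ≤ l) ↔ ((j : ℕ) < (l : ℕ) + 1) := by rw [Fin.le_iff_val_le_val]; omega
  simp only [this]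

/-- The recursion of prefix products. -/
theorem pre_succ (w : Fin D → ℝ) {r : ℕ} (hr : r < D) : pre (r + 1) w = pre r w * w ⟨r, hr⟩ := by
  unfold pre
  rw [← mul_prod_erase univ (fun j : Fin D => if (j : ℕ) < r + 1 then w j else 1) (mem_univ ⟨r, hr⟩),
    ← mul_prod_erase univ (fun j : Fin D => if (j : ℕ) < r then w j else 1) (mem_univ ⟨r, hr⟩)]
  have h1 : (∏ j ∈ univ.erase (⟨r, hr⟩ : Fin D), if (j : ℕ) < r + 1 then w j else (1 : ℝ)) =
      ∏ j ∈ univ.erase (⟨r, hr⟩ : Fin D), if (j : ℕ) < r then w j else (1 : ℝ) := by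
    refine prod_congr rfl fun j hj => ?_
    have hne : (j : ℕ) ≠ r := fun h => ne_of_mem_erase hj (Fin.ext h)
    have : ((j : ℕ) < r + 1) ↔ ((j : ℕ) < r) := by omega
    simp only [this]
  rw [h1]
  simp
  ring

/-- The empty prefix product. -/
theorem pre_zero (w : Fin D → ℝ) : pre 0 w = 1 := by simp [pre]

/-- Prefix products are positive. -/
theorem pre_pos {w : Fin D → ℝ} (hw : ∀ j, 0 < w j) (r : ℕ) : 0 < pre r w :=
  prod_pos fun j _ => by split_ifs <;> [exact hw j; exact one_pos]

/-- Prefix products beyond the depth are constant. -/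
theorem pre_succ_of_le (w : Fin D → ℝ) {r : ℕ} (hr : D ≤ r) : pre (r + 1) w = pre r w := by
  unfold pre
  refine prod_congr rfl fun j _ => ?_
  have h1 : (j : ℕ) < r := lt_of_lt_of_le j.2 hr
  have h2 : (j : ℕ) < r + 1 := Nat.lt_succ_of_lt h1
  simp [h1, h2]

/-- The anchor at level `0` is the value at the point. -/
theorem anc_zero (c₀ : ι → ℝ) (P : Fin D → ι → ℝ) (w : Fin D → ℝ) (c : ι) : anc c₀ P 0 w c = c₀ c := by
  simp [anc]

/-- The recursion of anchors. -/
theorem anc_succ (c₀ : ι → ℝ) (P : Fin D → ι → ℝ) {r : ℕ} (hr : r < D) (w : Fin D → ℝ) (c : ι) :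
    anc c₀ P (r + 1) w c = anc c₀ P r w c + cum w ⟨r, hr⟩ * P ⟨r, hr⟩ c := by
  unfold anc
  rw [add_assoc]
  congr 1
  have h : ∀ l : Fin D, (if (l : ℕ) < r + 1 then cum w l * P l c else 0) =
      (if (l : ℕ) < r then cum w l * P l c else 0) +
        (if l = ⟨r, hr⟩ then cum w l * P l c else 0) := by
    intro l
    rcases lt_trichotomy (l : ℕ) r with h | h | h
    · have h1 : (l : ℕ) < r + 1 := Nat.lt_succ_of_lt h
      have h2 : l ≠ ⟨r, hr⟩ := fun hh => absurd (congrArg Fin.val hh) h.ne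
      rw [if_pos h1, if_pos h, if_neg h2, add_zero]
    · have h1 : l = ⟨r, hr⟩ := Fin.ext h
      subst h1
      rw [if_pos (Nat.lt_succ_self _), if_neg (lt_irrefl _), if_pos rfl, zero_add]
    · have h1 : ¬(l : ℕ) < r + 1 := by omega
      have h2 : ¬(l : ℕ) < r := by omega
      have h3 : l ≠ ⟨r, hr⟩ := fun hh => absurd (congrArg Fin.val hh) h.ne'
      rw [if_neg h1, if_neg h2, if_neg h3, add_zero]
  rw [sum_congr rfl fun l _ => h l, sum_add_distrib, sum_ite_eq' univ, if_pos (Finset.mem_univ _)]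

/-- Anchors beyond the depth are constant. -/
theorem anc_succ_of_le (c₀ : ι → ℝ) (P : Fin D → ι → ℝ) {r : ℕ} (hr : D ≤ r) (w : Fin D → ℝ) (c : ι) :
    anc c₀ P (r + 1) w c = anc c₀ P r w c := by
  unfold anc
  congr 1
  refine sum_congr rfl fun l _ => ?_
  have h1 : (l : ℕ) < r := lt_of_lt_of_le l.2 hr
  have h2 : (l : ℕ) < r + 1 := Nat.lt_succ_of_lt h1
  simp [h1, h2]

/-! ### Separation of anchors -/

/-- **Distinct anchors at level `r` are `(g/2) · w₀ ⋯ w_{r-1}` apart.** -/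
theorem anc_sep (U : Finset ι) (c₀ : ι → ℝ) (P : Fin D → ι → ℝ) {g R : ℝ} (hg : 0 < g) (hR : 0 < R)
    (hsep0 : ∀ c ∈ U, ∀ c' ∈ U, c₀ c ≠ c₀ c' → g ≤ |c₀ c - c₀ c'|)
    (hsepP : ∀ l, ∀ c ∈ U, ∀ c' ∈ U, P l c ≠ P l c' → g ≤ |P l c - P l c'|)
    (hRP : ∀ l, ∀ c ∈ U, |P l c| ≤ R)
    {w : Fin D → ℝ} (hw : ∀ j, 0 < w j ∧ w j ≤ min (1 / 2) (g / (8 * R))) (r : ℕ) :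
    ∀ c ∈ U, ∀ c' ∈ U, anc c₀ P r w c ≠ anc c₀ P r w c' →
      g / 2 * pre r w ≤ |anc c₀ P r w c - anc c₀ P r w c'| := by
  induction r with
  | zero =>
    intro c hc c' hc' hne
    rw [anc_zero, anc_zero] at hne ⊢
    rw [pre_zero, mul_one]
    linarith [hsep0 c hc c' hc' hne]
  | succ r ih =>
    intro c hc c' hc' hne
    by_cases hr : r < D
    · rw [anc_succ c₀ P hr, anc_succ c₀ P hr] at hne ⊢
      rw [pre_succ w hr]
      set rf : Fin D := ⟨r, hr⟩ with hrf
      have hpre : 0 < pre r w := pre_pos (fun j => (hw j).1) r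
      have hcum : cum w rf = pre r w * w rf := by rw [cum_eq_pre, pre_succ w hr]
      have hwr := hw rf
      have hw2 : w rf ≤ 1 / 2 := hwr.2.trans (min_le_left _ _)
      have hw8 : w rf * (8 * R) ≤ g := by
        have := hwr.2.trans (min_le_right _ _)
        rwa [le_div_iff₀ (by positivity)] at this
      by_cases h1 : anc c₀ P r w c = anc c₀ P r w c'
      · -- the slopes at level `r` differ
        have hP : P rf c ≠ P rf c' := by
          intro hP; exact hne (by rw [h1, hP])
        have e : anc c₀ P r w c + cum w rf * P rf c - (anc c₀ P r w c' + cum w rf * P rf c') =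
            cum w rf * (P rf c - P rf c') := by rw [h1]; ring
        rw [e, abs_mul, abs_of_pos (cum_pos (fun j => (hw j).1) rf), hcum]
        have h2 := hsepP rf c hc c' hc' hP
        have h3 : 0 ≤ pre r w * w rf := (mul_pos hpre hwr.1).le
        nlinarith
      · -- the anchors at level `r` differ
        have h2 := ih c hc c' hc' h1
        have h3 : |cum w rf * (P rf c - P rf c')| ≤ pre r w * w rf * (2 * R) := by
          rw [abs_mul, abs_of_pos (cum_pos (fun j => (hw j).1) rf), hcum]
          refine mul_le_mul_of_nonneg_left ?_ (mul_pos hpre hwr.1).le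
          calc |P rf c - P rf c'| ≤ |P rf c| + |P rf c'| := abs_sub _ _
            _ ≤ R + R := add_le_add (hRP rf c hc) (hRP rf c' hc')
            _ = 2 * R := by ring
        have h4 : |anc c₀ P r w c - anc c₀ P r w c'| - |cum w rf * (P rf c - P rf c')| ≤
            |anc c₀ P r w c + cum w rf * P rf c - (anc c₀ P r w c' + cum w rf * P rf c')| := by
          have e : anc c₀ P r w c - anc c₀ P r w c' =
              (anc c₀ P r w c + cum w rf * P rf c - (anc c₀ P r w c' + cum w rf * P rf c')) +
                -(cum w rf * (P rf c - P rf c')) := by ring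
          have := abs_add_le (anc c₀ P r w c + cum w rf * P rf c - (anc c₀ P r w c' + cum w rf * P rf c'))
            (-(cum w rf * (P rf c - P rf c')))
          rw [← e, abs_neg] at this
          linarith
        have h5 : pre r w * w rf * (2 * R) ≤ g / 2 * pre r w * (1 / 2) := by nlinarith
        have h6 : g / 2 * pre r w * w rf ≤ g / 2 * pre r w * (1 / 2) :=
          mul_le_mul_of_nonneg_left hw2 (by positivity)
        rw [mul_assoc (g / 2) (pre r w) (w rf)] at h6
        linarith
    · push Not at hr
      rw [anc_succ_of_le c₀ P hr, anc_succ_of_le c₀ P hr] at hne ⊢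
      rw [pre_succ_of_le w hr]
      exact ih c hc c' hc' hne

/-! ### One level -/

/-- The core radius at level `r`: the switched-off levels contribute at most `D R · cum w r`. -/
theorem abs_nval_sub_anc_le (U : Finset ι) (c₀ : ι → ℝ) (P : Fin D → ι → ℝ) {R : ℝ} (hR : 0 < R)
    (hRP : ∀ l, ∀ c ∈ U, |P l c| ≤ R) {w : Fin D → ℝ} (hw : ∀ j, 0 < w j ∧ w j ≤ 1) (r : Fin D)
    (c : ι) (hc : c ∈ U) :
    |nval c₀ P w c - anc c₀ P r w c| ≤ D * R * cum w r := by
  have hw' : ∀ j, 0 ≤ w j ∧ w j ≤ 1 := fun j => ⟨(hw j).1.le, (hw j).2⟩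
  have e : nval c₀ P w c - anc c₀ P r w c = ∑ l : Fin D, if (l : ℕ) < r then 0 else cum w l * P l c := by
    unfold nval anc
    rw [add_sub_add_left_eq_sub, ← sum_sub_distrib]
    refine sum_congr rfl fun l _ => ?_
    split_ifs <;> ring
  rw [e]
  calc |∑ l : Fin D, if (l : ℕ) < r then 0 else cum w l * P l c|
      ≤ ∑ l : Fin D, |if (l : ℕ) < r then 0 else cum w l * P l c| := abs_sum_le_sum_abs _ _
    _ ≤ ∑ _l : Fin D, R * cum w r := sum_le_sum fun l _ => by
        split_ifs with h
        · rw [abs_zero]; exact mul_nonneg hR.le (cum_nonneg (fun j => (hw' j).1) r)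
        · rw [abs_mul, abs_of_nonneg (cum_nonneg (fun j => (hw' j).1) l), mul_comm]
          exact mul_le_mul (hRP l c hc) (cum_le_cum hw' (Fin.le_iff_val_le_val.2 (not_lt.1 h)))
            (cum_nonneg (fun j => (hw' j).1) l) hR.le
    _ = D * R * cum w r := by rw [sum_const, card_univ, Fintype.card_fin, nsmul_eq_mul]; ring

/-- The contraction identity at level `r`. -/
theorem nval_update (c₀ : ι → ℝ) (P : Fin D → ι → ℝ) (r : Fin D) (w : Fin D → ℝ) (σ : ℝ) (c : ι) :
    nval c₀ P (Function.update w r (σ * w r)) c =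
      anc c₀ P r w c + σ * (nval c₀ P w c - anc c₀ P r w c) := by
  unfold nval anc
  have e : ∀ l, cum (Function.update w r (σ * w r)) l * P l c =
      (if (l : ℕ) < r then cum w l * P l c else 0) + σ * (cum w l * P l c -
        (if (l : ℕ) < r then cum w l * P l c else 0)) := by
    intro l
    by_cases h : (l : ℕ) < r
    · rw [if_pos h, cum_update_of_lt w r _ (Fin.lt_def.2 h)]; ring
    · rw [if_neg h, cum_update_of_le w r σ (Fin.le_iff_val_le_val.2 (not_lt.1 h))]; ring
  rw [sum_congr rfl fun l _ => e l, sum_add_distrib, ← mul_sum, sum_sub_distrib]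
  ring

/-- The data of one contraction step at level `r`: positive core radius, core bound, separation
and contraction identity for `SepTwo.lmass_contract`. -/
theorem level_data (U : Finset ι) (c₀ : ι → ℝ) (P : Fin D → ι → ℝ) {g R : ℝ} (hg : 0 < g)
    (hR : 0 < R)
    (hsep0 : ∀ c ∈ U, ∀ c' ∈ U, c₀ c ≠ c₀ c' → g ≤ |c₀ c - c₀ c'|)
    (hsepP : ∀ l, ∀ c ∈ U, ∀ c' ∈ U, P l c ≠ P l c' → g ≤ |P l c - P l c'|)
    (hRP : ∀ l, ∀ c ∈ U, |P l c| ≤ R) (r : Fin D)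
    {w : Fin D → ℝ} (hw : ∀ j, 0 < w j ∧ w j ≤ min (1 / 2) (g / (28 * D * R))) (σ : ℝ) :
    0 < 2 * D * R * cum w r ∧
    (∀ c ∈ U, |nval c₀ P w c - anc c₀ P r w c| ≤ 2 * D * R * cum w r / 2) ∧
    (∀ c ∈ U, ∀ c' ∈ U, anc c₀ P r w c ≠ anc c₀ P r w c' →
      7 * (2 * D * R * cum w r) ≤ |anc c₀ P r w c - anc c₀ P r w c'|) ∧
    (∀ c ∈ U, nval c₀ P (Function.update w r (σ * w r)) c =
      anc c₀ P r w c + σ * (nval c₀ P w c - anc c₀ P r w c)) := by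
  have hD : 0 < D := Fin.pos r
  have hDr : (0 : ℝ) < D := Nat.cast_pos.2 hD
  have hw1 : ∀ j, 0 < w j ∧ w j ≤ 1 := fun j =>
    ⟨(hw j).1, (hw j).2.trans ((min_le_left _ _).trans (by norm_num))⟩
  have hw8 : ∀ j, 0 < w j ∧ w j ≤ min (1 / 2) (g / (8 * R)) := by
    intro j
    refine ⟨(hw j).1, le_min ((hw j).2.trans (min_le_left _ _)) (((hw j).2.trans (min_le_right _ _)).trans ?_)⟩
    rw [div_le_div_iff₀ (by positivity) (by positivity)]
    have : (1 : ℝ) ≤ D := Nat.one_le_cast.2 hD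
    have hgR := mul_pos hg hR
    nlinarith [mul_le_mul_of_nonneg_left this hgR.le]
  refine ⟨by have := cum_pos (fun j => (hw j).1) r; positivity, fun c hc => ?_,
    fun c hc c' hc' hne => ?_, fun c _ => nval_update c₀ P r w σ c⟩
  · have := abs_nval_sub_anc_le U c₀ P hR hRP hw1 r c hc
    linarith
  · have hsep := anc_sep U c₀ P hg hR hsep0 hsepP hRP hw8 r c hc c' hc' hne
    have hcum : cum w r = pre r w * w r := by rw [cum_eq_pre, pre_succ w r.2]
    have hpre : 0 < pre r w := pre_pos (fun j => (hw j).1) r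
    have hw28 : w r * (28 * D * R) ≤ g := by
      have := (hw r).2.trans (min_le_right _ _)
      rwa [le_div_iff₀ (by positivity)] at this
    rw [hcum]
    nlinarith

/-- **Contracting one coordinate costs a logarithm.** -/
theorem lmass_level_log (lo hi : Fin k → Fin k ⊕ ι) (a : Fin k → Option ι) (U : Finset ι)
    (hlo : ∀ i c, lo i = Sum.inr c → c ∈ U) (hhi : ∀ i c, hi i = Sum.inr c → c ∈ U)
    (ha : ∀ i c, a i = some c → c ∈ U) (c₀ : ι → ℝ) (P : Fin D → ι → ℝ) {g R : ℝ} (hg : 0 < g)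
    (hR : 0 < R)
    (hsep0 : ∀ c ∈ U, ∀ c' ∈ U, c₀ c ≠ c₀ c' → g ≤ |c₀ c - c₀ c'|)
    (hsepP : ∀ l, ∀ c ∈ U, ∀ c' ∈ U, P l c ≠ P l c' → g ≤ |P l c - P l c'|)
    (hRP : ∀ l, ∀ c ∈ U, |P l c| ≤ R) (r : Fin D)
    {w : Fin D → ℝ} (hw : ∀ j, 0 < w j ∧ w j ≤ min (1 / 2) (g / (28 * D * R)))
    {σ : ℝ} (hσ0 : 0 < σ) (hσ1 : σ ≤ 1) :
    lmass lo hi a (nval c₀ P (Function.update w r (σ * w r))) ≤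
      ENNReal.ofReal (5 * (1 + Real.log σ⁻¹)) ^ (k * U.card) * lmass lo hi a (nval c₀ P w) := by
  obtain ⟨hℓ, hcore, hsep, hcontr⟩ := level_data U c₀ P hg hR hsep0 hsepP hRP r hw σ
  set ℓ : ℝ := 2 * D * R * cum w r with hℓ_def
  have hw1 : 1 ≤ wexp ℓ (2 * ℓ) σ := one_le_wexp ⟨hℓ, le_rfl, hσ0, hσ1⟩
  have hA1 : (1 : ℝ) ≤ 3 * wexp ℓ (2 * ℓ) σ := by linarith
  have hA5 : 3 * wexp ℓ (2 * ℓ) σ ≤ 5 * (1 + Real.log σ⁻¹) := three_wexp_le hℓ hσ0 hσ1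
  have h := lmass_contract lo hi a U hlo hhi ha (nval c₀ P w)
    (nval c₀ P (Function.update w r (σ * w r))) (anc c₀ P r w) σ ℓ (2 * ℓ)
    (3 * wexp ℓ (2 * ℓ) σ) hA1 ⟨hσ0, hσ1⟩ ⟨hℓ, le_rfl⟩ hcore
    (fun c hc c' hc' hne => by linarith [hsep c hc c' hc' hne]) hcontr
    (fun m => hwin_of_window hℓ le_rfl hσ0 hσ1 m)
  calc lmass lo hi a (nval c₀ P (Function.update w r (σ * w r)))
      ≤ ENNReal.ofReal (3 * wexp ℓ (2 * ℓ) σ) ^ (k * U.card) * lmass lo hi a (nval c₀ P w) := h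
    _ ≤ ENNReal.ofReal (5 * (1 + Real.log σ⁻¹)) ^ (k * U.card) * lmass lo hi a (nval c₀ P w) := by
        gcongr

/-- **Contracting one coordinate by a factor `σ ∈ [1/4, 1]` costs `9^{k·#U}`.** -/
theorem lmass_level_nine (lo hi : Fin k → Fin k ⊕ ι) (a : Fin k → Option ι) (U : Finset ι)
    (hlo : ∀ i c, lo i = Sum.inr c → c ∈ U) (hhi : ∀ i c, hi i = Sum.inr c → c ∈ U)
    (ha : ∀ i c, a i = some c → c ∈ U) (c₀ : ι → ℝ) (P : Fin D → ι → ℝ) {g R : ℝ} (hg : 0 < g)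
    (hR : 0 < R)
    (hsep0 : ∀ c ∈ U, ∀ c' ∈ U, c₀ c ≠ c₀ c' → g ≤ |c₀ c - c₀ c'|)
    (hsepP : ∀ l, ∀ c ∈ U, ∀ c' ∈ U, P l c ≠ P l c' → g ≤ |P l c - P l c'|)
    (hRP : ∀ l, ∀ c ∈ U, |P l c| ≤ R) (r : Fin D)
    {w : Fin D → ℝ} (hw : ∀ j, 0 < w j ∧ w j ≤ min (1 / 2) (g / (28 * D * R)))
    {σ : ℝ} (hσ : 1 / 4 ≤ σ ∧ σ ≤ 1) :
    lmass lo hi a (nval c₀ P (Function.update w r (σ * w r))) ≤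
      (9 : ℝ≥0∞) ^ (k * U.card) * lmass lo hi a (nval c₀ P w) := by
  obtain ⟨hℓ, hcore, hsep, hcontr⟩ := level_data U c₀ P hg hR hsep0 hsepP hRP r hw σ
  exact lmass_contract_nine lo hi a U hlo hhi ha (nval c₀ P w)
    (nval c₀ P (Function.update w r (σ * w r))) (anc c₀ P r w) σ (2 * D * R * cum w r) hσ hℓ hcore
    hsep hcontr

/-! ### All levels -/

/-- **The fibre mass is almost decreasing towards the corner** along a nested sector of any depth:
moving towards the corner within ratio `4` in every coordinate costs `9^{D·k·#U}`. -/
theorem lmass_corner_mono_all (lo hi : Fin k → Fin k ⊕ ι) (a : Fin k → Option ι) (U : Finset ι)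
    (hlo : ∀ i c, lo i = Sum.inr c → c ∈ U) (hhi : ∀ i c, hi i = Sum.inr c → c ∈ U)
    (ha : ∀ i c, a i = some c → c ∈ U) (c₀ : ι → ℝ) (P : Fin D → ι → ℝ) {g R : ℝ} (hg : 0 < g)
    (hR : 0 < R)
    (hsep0 : ∀ c ∈ U, ∀ c' ∈ U, c₀ c ≠ c₀ c' → g ≤ |c₀ c - c₀ c'|)
    (hsepP : ∀ l, ∀ c ∈ U, ∀ c' ∈ U, P l c ≠ P l c' → g ≤ |P l c - P l c'|)
    (hRP : ∀ l, ∀ c ∈ U, |P l c| ≤ R)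
    {w w' : Fin D → ℝ} (hw : ∀ j, 0 < w j) (hww' : ∀ j, w j ≤ w' j) (hw'w : ∀ j, w' j ≤ 4 * w j)
    (hw' : ∀ j, w' j ≤ min (1 / 2) (g / (28 * D * R))) :
    lmass lo hi a (nval c₀ P w) ≤ (9 : ℝ≥0∞) ^ (D * (k * U.card)) * lmass lo hi a (nval c₀ P w') := by
  -- intermediate points
  set mid : ℕ → Fin D → ℝ := fun m (j : Fin D) => if (j : ℕ) < m then w' j else w j with hmid
  have hmid_pos : ∀ m j, 0 < mid m j := by
    intro m j; simp only [hmid]; split_ifs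
    · exact (hw j).trans_le (hww' j)
    · exact hw j
  have hmid_le : ∀ m j, mid m j ≤ min (1 / 2) (g / (28 * D * R)) := by
    intro m j; simp only [hmid]; split_ifs
    · exact hw' j
    · exact (hww' j).trans (hw' j)
  have h0 : mid 0 = w := funext fun j => by simp [hmid]
  have hD : mid D = w' := funext fun j => by simp [hmid, j.2]
  have hstep : ∀ m (hm : m < D), mid m =
      Function.update (mid (m + 1)) ⟨m, hm⟩ ((w ⟨m, hm⟩ / w' ⟨m, hm⟩) * mid (m + 1) ⟨m, hm⟩) := by
    intro m hm
    funext j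
    by_cases hj : j = ⟨m, hm⟩
    · subst hj
      have hw'0 : w' ⟨m, hm⟩ ≠ 0 := ((hw _).trans_le (hww' _)).ne'
      rw [Function.update_self]
      have e1 : mid m ⟨m, hm⟩ = w ⟨m, hm⟩ := by simp [hmid]
      have e2 : mid (m + 1) ⟨m, hm⟩ = w' ⟨m, hm⟩ := by simp [hmid]
      rw [e1, e2, div_mul_cancel₀ _ hw'0]
    · rw [Function.update_of_ne hj]
      have hjm : (j : ℕ) ≠ m := fun h => hj (Fin.ext h)
      simp only [hmid]
      have : ((j : ℕ) < m) ↔ ((j : ℕ) < m + 1) := by omega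
      simp only [this]
  have key : ∀ m, m ≤ D → lmass lo hi a (nval c₀ P (mid 0)) ≤
      (9 : ℝ≥0∞) ^ (m * (k * U.card)) * lmass lo hi a (nval c₀ P (mid m)) := by
    intro m
    induction m with
    | zero => intro _; simp
    | succ m ih =>
      intro hm
      have hm' : m < D := Nat.lt_of_succ_le hm
      have h1 := ih hm'.le
      have hσ : 1 / 4 ≤ w ⟨m, hm'⟩ / w' ⟨m, hm'⟩ ∧ w ⟨m, hm'⟩ / w' ⟨m, hm'⟩ ≤ 1 := by
        have hw'0 : 0 < w' ⟨m, hm'⟩ := (hw _).trans_le (hww' _)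
        constructor
        · rw [le_div_iff₀ hw'0]; linarith [hw'w ⟨m, hm'⟩]
        · rw [div_le_one hw'0]; exact hww' _
      have h2 := lmass_level_nine lo hi a U hlo hhi ha c₀ P hg hR hsep0 hsepP hRP ⟨m, hm'⟩
        (w := mid (m + 1)) (fun j => ⟨hmid_pos _ j, hmid_le _ j⟩) hσ
      rw [← hstep m hm'] at h2
      calc lmass lo hi a (nval c₀ P (mid 0))
          ≤ (9 : ℝ≥0∞) ^ (m * (k * U.card)) * lmass lo hi a (nval c₀ P (mid m)) := h1
        _ ≤ (9 : ℝ≥0∞) ^ (m * (k * U.card)) * ((9 : ℝ≥0∞) ^ (k * U.card) *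
            lmass lo hi a (nval c₀ P (mid (m + 1)))) := mul_le_mul_right h2 _
        _ = (9 : ℝ≥0∞) ^ ((m + 1) * (k * U.card)) * lmass lo hi a (nval c₀ P (mid (m + 1))) := by
            rw [← mul_assoc, ← pow_add, add_mul, one_mul]
  have := key D le_rfl
  rwa [h0, hD] at this

end SepAll

/-- **The fibre mass is almost decreasing towards the corner along a nested sector of any depth**
(registered part of `stub_separateHigh_hH`; literal form of `SepAll.lmass_corner_mono_all`): with
atom values `c₀ c + ∑_l (∏_{j ≤ l} w j) · P l c`, common separation `g` of the distinct values and
slopes, slope bound `R`, moving towards the corner within ratio `4` in every coordinate multiplies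
the fibre mass by at most `9^{D·k·#U}` in the range `w' j ≤ min (1/2) (g/(28 D R))`. -/
theorem separateAllHH_mass (k D : ℕ) (ι : Type) (lo hi : Fin k → Fin k ⊕ ι) (a : Fin k → Option ι) (U : Finset ι) (hlo : ∀ i c, lo i = Sum.inr c → c ∈ U) (hhi : ∀ i c, hi i = Sum.inr c → c ∈ U) (ha : ∀ i c, a i = some c → c ∈ U) (c₀ : ι → ℝ) (P : Fin D → ι → ℝ) (g R : ℝ) (hg : 0 < g) (hR : 0 < R) (hsep0 : ∀ c ∈ U, ∀ c' ∈ U, c₀ c ≠ c₀ c' → g ≤ |c₀ c - c₀ c'|) (hsepP : ∀ l, ∀ c ∈ U, ∀ c' ∈ U, P l c ≠ P l c' → g ≤ |P l c - P l c'|) (hRP : ∀ l, ∀ c ∈ U, |P l c| ≤ R) (w w' : Fin D → ℝ) (hw : ∀ j, 0 < w j) (hww' : ∀ j, w j ≤ w' j) (hw'w : ∀ j, w' j ≤ 4 * w j) (hw' : ∀ j, w' j ≤ min (1 / 2) (g / (28 * D * R))) : MeasureTheory.lintegral (MeasureTheory.volume.restrict {t : Fin k → ℝ | ∀ i, Sum.elim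 t (fun c => c₀ c + ∑ l, (∏ j, if j ≤ l then w j else 1) * P l c) (lo i) < t i ∧ t i < Sum.elim t (fun c => c₀ c + ∑ l, (∏ j, if j ≤ l then w j else 1) * P l c) (hi i)}) (fun t => ∏ i, (a i).elim 1 (fun c => ENNReal.ofReal |t i - (c₀ c + ∑ l, (∏ j, if j ≤ l then w j else 1) * P l c)|⁻¹)) ≤ (9 : ENNReal) ^ (D * (k * U.card)) * MeasureTheory.lintegral (MeasureTheory.volume.restrict {t : Fin k → ℝ | ∀ i, Sum.elim t (fun c => c₀ c + ∑ l, (∏ j, if j ≤ l then w' j else 1) * P l c) (lo i) < t i ∧ t i < Sum.elim t (fun c => c₀ c + ∑ l, (∏ j, if j ≤ l then w' j else 1) * P l c) (hi i)}) (fun t => ∏ i, (a i).elim 1 (fun c => ENNReal.ofReal |t i - (c₀ c + ∑ l, (∏ j, if j ≤ l then w' j else 1) * P l c)|⁻¹)) := by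
  exact SepAll.lmass_corner_mono_all lo hi a U hlo hhi ha c₀ P hg hR hsep0 hsepP hRP hw hww' hw'w hw'

end Summit.KontsevichZagierPeriods.ArrangementNormalForm.JanusBands
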